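import Mathlib.AlgebraicGeometry.FunctionField
import Mathlib.RingTheory.Kaehler.Basic
import Mathlib.LinearAlgebra.ExteriorPower.Basic
import Mathlib.Order.Preorder.Chain
import Literature.AlgebraicGeometry.Motives.LogSmoothDegeneration
import Literature.AlgebraicGeometry.Motives.CartierDivisorCurveDegree
import HarnessLib

/-!
# Log Calabi–Yau pairs with simple normal crossings: dual complex, complexity, crepant models

Topic: `Literature/AlgebraicGeometry/LogCalabiYau` (definition request `defn-LogCalabiYauDualComplex`
of route `SmoothPoincare4/LogCYSkeleton`, informal cruxes NonMax / BirationalCertificate /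
SkeletonComparison). This is the FIRST CUT asked for there: the notions of Mauri–Moraga 2024
and Kollár–Xu 2016 for LOG SMOOTH pairs `(X, B)` — `X` smooth and proper over a field `k`, `B` a
reduced strict normal crossings divisor, `K_X + B ∼ 0` — where log canonicity is automatic and the
dual complex is defined directly; general lc / dlt pairs are NOT covered (see "not here").

## The printed definitions

* Mauri–Moraga 2024, Def. 1.1: "A log Calabi–Yau pair `(X,B)` consists of a proper variety `X`
  and an effective `ℝ`-divisor `B` such that the pair `(X,B)` is log canonical and `K_X + B` is
  `ℝ`-linearly trivial." (§2: over an algebraically closed field of characteristic zero.)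
  Kollár–Xu 2016, Def. 1: `(X, Δ)` log canonical, `K_Y + Δ_Y ∼_ℚ g^*(K_X + Δ)` for a crepant log
  resolution; "`Δ_Y^{=1}` denotes the union of all irreducible components of `Δ_Y` whose coefficient
  equals `1`. The combinatorics of `Δ_Y^{=1}` is encoded in its dual complex".
* de Fernex–Kollár–Xu 2012, Definition 8 (= Kollár–Xu 2016, Def. 12 "Dual complex"): for
  `Z = ⋃ Zᵢ` with (1) each `Zᵢ` normal and (2) every connected component of every `⋂_{i∈J} Zᵢ`
  irreducible of codimension `|J| - 1`: "The dual complex `𝒟(Z)` of `Z` is the regular cell complex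
  obtained as follows. The vertices are the irreducible components of `Z` and to each irreducible
  component of `W ⊂ ⋂_{i∈J} Zᵢ` we associate a cell of dimension `|J| - 1` […] `v_W`. The attaching
  map is given by condition (3) [every irreducible component of `⋂_{i∈J} Zᵢ` is contained in a
  unique irreducible component of `⋂_{i ∈ J∖{j}} Zᵢ`]. Note that `𝒟(Z)` is a simplicial complex iff
  `⋂_{i∈J} Zᵢ` is irreducible (or empty) for every `J ⊂ I`." (4): (1–2) hold for `X` smooth and
  `E` a simple normal crossing divisor. Remark 10: "The barycentric subdivision of any dual
  complex is simplicial." Prop. 11: crepant birational dlt pairs have PL-homeomorphic dual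
  complexes. Mauri–Moraga 2024, Def. 2.20–2.21 restate this for (g)dlt pairs.
* Mauri–Moraga 2024, Def. 2.25: "`c(X,B,𝐌) := dim X + rank Cl_ℚ(X) - |B|`", `|B| = Σ aᵢ`;
  Brown–McKernan–Svaldi–Zong 2018, Def. 7: the absolute complexity `γ = n + ρ - d`, "`ρ` is the
  rank of the group of Weil divisors modulo algebraic equivalence […] If `X` is `ℚ`-factorial then
  `ρ` is the Picard number". Def. 2.27: `(X',B')` is a crepant model of `(X,B)` if `X'` is
  birational to `X` and `p^*(K_X + B) = q^*(K_{X'} + B')` on a common resolution. Def. 2.28: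
  `c_bir(X,B) := inf { c(X',B') | (X',B') a crepant model }`.

## Rendering

* **Dual complex** (`Cell`, `baryDualComplex`, for any subset `Z` of a topological space; applied
  to `Z = B`): a cell `v_W` is a pair (`J` a non-empty finite set of components of `Z`, indexed by
  their generic points `Resolution.maxPoints Z`; `W` an irreducible component of the stratum
  `Z_J = Z ∩ ⋂_{η∈J} cl{η}` = `Motives.stratum Z J`, recorded by its generic point); the face
  order is `v_{W'} ≤ v_W ↔ J' ⊆ J ∧ W ⊆ W'` (a partial order); `baryDualComplex Z` is the ORDER
  COMPLEX of this poset, Mathlib's `AbstractSimplicialComplex` on `Cell Z` — by Remark 10 of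
  loc. cit. the barycentric subdivision of the regular `Δ`-complex `𝒟(Z)`, hence PL-homeomorphic
  to it; PL-homeomorphism type, simple-homotopy type and collapsibility statements about `𝒟(X,B)`
  are to be read on this finite abstract simplicial complex (its face set `.faces : Set (Finset _)`
  is the shape consumed by `Literature.Topology.FourManifolds.IsFaceCollapsible`), and its
  realisation `baryDualComplexSpace` (`Motives.stdRealisation`) is `|𝒟(Z)|` as a space. When all
  strata are irreducible (`IsSimplicial`, loc. cit.) `𝒟(Z)` is already simplicial and equals the
  NERVE `Motives.dualComplex Z` of `LogSmoothDegeneration.lean` (`Cell.J` is then injective,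
  `IsSimplicial.J_injective`; in general the nerve is a strict quotient).
* **`K_X + B ∼ 0`** (`IsLogVolumeForm`): Mathlib has no canonical sheaf, so the condition is
  written on RATIONAL VOLUME FORMS `ω ∈ ⋀ⁿ_{K(X)} Ω_{K(X)/k}` (`RatForms`, Mathlib's
  `KaehlerDifferential` and `exteriorPower` of the function field): the stalk `Ωⁿ_{X,p}` is the
  `𝒪_{X,p}`-span of the `dg₁ ∧ ⋯ ∧ dgₙ`, `gᵢ ∈ 𝒪_{X,p}` (`regularForms`), and `div(ω) = -B` says
  that `b · ω` generates `Ωⁿ_{X,p}` for a local equation `b` of `B` at `p`, at every `p`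
  (`(I_B)_p = (b)`, `Resolution.stalkIdeal` of Mathlib's `vanishingIdeal`; `b` a unit off `B`). For
  `X` smooth of relative dimension `n` such an `ω` exists iff the Cartier divisor `K_X + B` is
  principal, i.e. `K_X + B ∼ 0` with `ℤ`-coefficients (the form printed by Kollár–Xu as
  `K_X + Δ ∼ 0` in Question 7 and used by the route). The local rings are read inside an abstract
  field `F` through a chart `e : F ≃ₐ[k] K(X)` (`stalkSubring`) so that ONE form can be tested on
  two birational models without any functoriality of `Ω` and `⋀`.
* **Pairs** (`SncLogCalabiYauPair k n`): `X : Motives.SchemeOver k` integral, proper, smooth of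
  relative dimension `n`; `B ⊆ X` with `Resolution.IsStrictNormalCrossingsDivisor X B` (de Jong
  2.4; `B = ∅` allowed); `∃ ω, IsLogVolumeForm B ω`. Such a pair is lc, indeed dlt with `Z = ∅`
  (Kollár–Mori 1998, Cor. 2.31 (3) and Def. 2.37), so it IS a log Calabi–Yau pair in the printed
  sense, with `B = B^{=1}` reduced.
* **Complexity** (`complexity = n + picardNumber X - numComponents`): `ρ(X)` is rendered as the
  rank of `N¹(X)` = the largest size of a NUMERICALLY independent family of Cartier divisors
  (`picardNumber`, via the tree's `CartierDivisor.degree` on closed integral curves and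
  `CartierDivisor.classPullback`); for smooth proper `X` this is the rank of divisors modulo
  algebraic equivalence of BMSZ Def. 7 (Matsusaka 1957), `= rank Cl(X)_ℚ` as Mauri–Moraga use it
  (`ρ(X)` for `ℚ`-factorial `X`, Lemmas 2.30–2.31). `|B|` = number of components (`maxPoints`).
* **Crepant models** (`IsCrepantBirational`): for two pairs with `K + B ∼ 0` Def. 2.27 is
  equivalent to: a `k`-isomorphism `σ : K(X) ≃ K(X')` (= a birational map) and ONE rational
  volume form with `div_X ω = -B`, `div_{X'} ω = -B'` (proof in the docstring); no resolution of
  singularities is needed to state it. `BirationalComplexityLT P m` (`∃` crepant snc model with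
  `c < m`) is the junk-free form of "`c_bir < m`"; `sncBirationalComplexity` the `sInf`.

## What is NOT here (deliberately; TODO(general form))

* Discrepancies, log canonical / klt / dlt / generalized pairs (Kollár–Mori 2.34–2.37,
  Mauri–Moraga §2.1), `ℚ`/`ℝ`-boundaries and `ℝ`-linear triviality, dlt modifications and
  Def. 2.21 (the dual complex of a NON-dlt lc pair as a PL type), b-nef divisors `𝐌`.
  Consequently `BirationalComplexityLT` minimises over snc models with reduced boundary only —
  it implies, but is a priori stronger than, `c_bir < m` of Def. 2.28 (attained by a
  `ℚ`-factorial dlt model, Lemma 2.31).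
* PL topology of `𝒟` (PL manifold, PL sphere, collapses): requested separately from
  `Literature/Topology` (abstract-complex toolkit); this file delivers the finite abstract
  simplicial complex. No theorem of the sources (Thm. 1.6/1.10/7.1, dFKX Prop. 11, KX §4) is
  vendored here.
* Projectivity (`Motives.IsProjectiveOver` can be added by consumers; the sources ask proper),
  the ground field being `ℂ` or algebraically closed (a parameter `k`).

## Sources

* M. Mauri, J. Moraga, *Birational complexity and dual complexes*, arXiv:2402.10136 (2024),
  Def. 1.1 (p. 3), §2 (p. 7), Def. 2.20–2.21, 2.23, 2.25, 2.27–2.28, Lemmas 2.30–2.31 (pp. 11–12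
  of the held text). [MauriMoraga2024]
* T. de Fernex, J. Kollár, C. Xu, *The dual complex of singularities*, arXiv:1212.1675, §2,
  Definitions 7–8, Say 9, Remark 10, Prop. 11 (pp. 5–6 of the held text). [FernexKollarXu2012]
* J. Kollár, C. Xu, *The dual complex of Calabi–Yau pairs*, Invent. Math. 205 (2016)
  (arXiv:1503.08320), Def. 1, Def. 12, Question 7. [KollarXu2015]
* M. Brown, J. McKernan, R. Svaldi, H. Zong, *A geometric characterization of toric varieties*,
  Duke Math. J. 167 (2018), Def. 1 and Def. 7 (p. 3 of arXiv:1605.08911). [BrownMcKernanSvaldiZong2018]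
* J. Kollár, S. Mori, *Birational geometry of algebraic varieties* (1998), Notation 0.4 (8),
  Cor. 2.31, Def. 2.37. [KollarMori1998]
* R. Hartshorne, *Algebraic Geometry*, II.6 (Cartier divisors, `CaCl ≅ Pic`), II.8 (differentials,
  canonical sheaf). [Hartshorne1977]
-/

noncomputable section

open CategoryTheory AlgebraicGeometry TopologicalSpace IsLocalRing
open scoped _root_.Topology

universe u

namespace Literature.AlgebraicGeometry.LogCalabiYau

open Literature.AlgebraicGeometry.Resolution Literature.AlgebraicGeometry.Motives
open Scheme.IdealSheafData

/-! ## The order complex of a preorder -/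

section OrderComplex

variable (P : Type*) [Preorder P]

/-- The **order complex** (flag complex) of a preorder `P`: the abstract simplicial complex on
`P` whose faces are the non-empty finite chains. Applied to the face poset of a regular cell
complex it is the barycentric subdivision of that complex. [folklore] -/
def orderComplex : AbstractSimplicialComplex P where
  faces := {s | s.Nonempty ∧ IsChain (· ≤ ·) (s : Set P)}
  isRelLowerSet_faces := fun _ hs =>
    ⟨hs.1, fun _ hts ht => ⟨ht, hs.2.mono (Finset.coe_subset.mpr hts)⟩⟩
  singleton_mem v := ⟨Finset.singleton_nonempty v, by
    rw [Finset.coe_singleton]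
    exact Set.subsingleton_singleton.isChain⟩

variable {P}

/-- Unfolding lemma: the faces of the order complex are the non-empty finite chains.
[folklore] -/
theorem mem_orderComplex_faces_iff {s : Finset P} :
    s ∈ (orderComplex P).faces ↔ s.Nonempty ∧ IsChain (· ≤ ·) (s : Set P) :=
  Iff.rfl

/-- A comparable pair spans an edge of the order complex. [folklore] -/
theorem pair_mem_orderComplex_faces [DecidableEq P] {a b : P} (h : a ≤ b) :
    ({a, b} : Finset P) ∈ (orderComplex P).faces := by
  refine ⟨Finset.insert_nonempty a {b}, ?_⟩
  rw [Finset.coe_insert, Finset.coe_singleton]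
  exact IsChain.insert Set.subsingleton_singleton.isChain fun c hc _ => by
    rw [Set.mem_singleton_iff] at hc
    subst hc
    exact Or.inl h

end OrderComplex

/-! ## The dual complex of a subset of a topological space (de Fernex–Kollár–Xu, Def. 8) -/

section DualComplex

variable {α : Type*} [TopologicalSpace α]

/-- A **cell** of the dual complex `𝒟(Z)` of a subset `Z` of a topological space
(de Fernex–Kollár–Xu 2012, Definition 8: "The vertices are the irreducible components of `Z`
and to each irreducible component of `W ⊂ ⋂_{i ∈ J} Zᵢ` we associate a cell of dimension
`|J| - 1`. This cell is usually denoted by `v_W`."): a non-empty finite set `J` of irreducible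
components of `Z` (indexed by their generic points, `Resolution.maxPoints Z`) together with
an irreducible component `W` of the stratum `Z_J = Z ∩ ⋂_{η ∈ J} \overline{{η}}`
(`Motives.stratum Z J`), recorded through its generic point `gen ∈ maxPoints Z_J`.
[cite: FernexKollarXu2012, Definition 8] -/
@[ext]
structure Cell (Z : Set α) where
  /-- the set `J` of components of `Z` being intersected -/
  J : Finset (maxPoints Z)
  /-- `J` is non-empty -/
  nonempty : J.Nonempty
  /-- the generic point of the irreducible component `W` of the stratum `Z_J` -/
  gen : α
  /-- `gen` is a maximal point of the stratum `Z_J` -/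
  gen_mem : gen ∈ maxPoints (stratum Z J)

namespace Cell

variable {Z : Set α}

/-- The generic point of a cell lies on its stratum. [folklore] -/
theorem gen_mem_stratum (c : Cell Z) : c.gen ∈ stratum Z c.J :=
  maxPoints_subset _ c.gen_mem

/-- The generic point of a cell lies on `Z`. [folklore] -/
theorem gen_mem_self (c : Cell Z) : c.gen ∈ Z :=
  stratum_subset Z c.J c.gen_mem_stratum

/-- The **dimension** `|J| - 1` of the cell `v_W`, `W ⊆ Z_J` (de Fernex–Kollár–Xu 2012,
Definition 8). `J` is non-empty, so the natural-number subtraction is the honest dimension.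
[cite: FernexKollarXu2012, Definition 8] -/
def dim (c : Cell Z) : ℕ :=
  c.J.card - 1

/-- `dim v_W + 1 = |J|`. [folklore] -/
theorem dim_add_one (c : Cell Z) : c.dim + 1 = c.J.card :=
  Nat.sub_add_cancel (Finset.card_pos.mpr c.nonempty)

/-- The **face order** on cells: `v_{W'} ≤ v_W` iff `J' ⊆ J` and `W ⊆ W'`, the latter
written `gen W' ⤳ gen W` (de Fernex–Kollár–Xu 2012, Definition 8 (3): "every irreducible
component of `⋂_{i ∈ J} Zᵢ` is contained in a unique irreducible component of
`⋂_{i ∈ J ∖ {j}} Zᵢ`" — the attaching maps of the regular cell complex `𝒟(Z)`). It is a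
partial order: antisymmetry holds because distinct maximal points of one stratum do not
specialise to each other. [cite: FernexKollarXu2012, Definition 8] -/
instance : PartialOrder (Cell Z) where
  le c c' := c.J ⊆ c'.J ∧ c.gen ⤳ c'.gen
  le_refl c := ⟨subset_rfl, specializes_rfl⟩
  le_trans _ _ _ hab hbc := ⟨hab.1.trans hbc.1, hab.2.trans hbc.2⟩
  le_antisymm a b hab hba := by
    have hJ : a.J = b.J := subset_antisymm hab.1 hba.1
    have hb : b.gen ∈ stratum Z a.J := hJ ▸ b.gen_mem_stratum
    exact Cell.ext hJ (a.gen_mem.2 b.gen hb hba.2).symm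

/-- Unfolding lemma for the face order. [folklore] -/
theorem le_iff {c c' : Cell Z} : c ≤ c' ↔ c.J ⊆ c'.J ∧ c.gen ⤳ c'.gen :=
  Iff.rfl

/-- Faces have smaller dimension. [folklore] -/
theorem dim_le_of_le {c c' : Cell Z} (h : c ≤ c') : c.dim ≤ c'.dim :=
  Nat.sub_le_sub_right (Finset.card_le_card h.1) 1

/-- The **vertex** of `𝒟(Z)` attached to an irreducible component of `Z` (its generic point
`η` is a maximal point of the stratum `Z_{{η}} = Z ∩ \overline{{η}}`). [folklore] -/
def vertex (η : maxPoints Z) : Cell Z where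
  J := {η}
  nonempty := Finset.singleton_nonempty η
  gen := η
  gen_mem := ⟨coe_mem_stratum_singleton η,
    fun η' hη' h => η.2.2 η' (stratum_subset Z _ hη') h⟩

/-- Vertices are `0`-dimensional cells. [folklore] -/
@[simp]
theorem dim_vertex (η : maxPoints Z) : (vertex η).dim = 0 := by
  simp [dim, vertex]

/-- `vertex` is injective. [folklore] -/
theorem vertex_injective : Function.Injective (vertex (Z := Z)) :=
  fun _ _ h => Subtype.ext (congrArg Cell.gen h)

/-- A cell of dimension `0` is a vertex. [folklore] -/
theorem exists_eq_vertex_of_dim_eq_zero {c : Cell Z} (h : c.dim = 0) : ∃ η, c = vertex η := by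
  have hcard : c.J.card = 1 := by have := c.dim_add_one; omega
  obtain ⟨η, hη⟩ := Finset.card_eq_one.mp hcard
  refine ⟨η, Cell.ext hη ?_⟩
  have hgen : c.gen ∈ stratum Z {η} := hη ▸ c.gen_mem_stratum
  -- `c.gen` is maximal in `Z_{{η}} ∋ η` and `η ⤳ c.gen`, so `η = c.gen`.
  have hmax := c.gen_mem.2
  rw [hη] at hmax
  exact (hmax η (coe_mem_stratum_singleton η) (hgen.2 η (Finset.mem_singleton_self η))).symm
    ▸ rfl

/-- The set of components `J` of a cell is a face of the NERVE of the covering of `Z` by its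
components (`Motives.dualComplex Z`, Morrison's dual graph): the comparison map from the
cells of `𝒟(Z)` to the simplices of the nerve. [folklore] -/
theorem J_mem_dualComplex_faces (c : Cell Z) : c.J ∈ (Motives.dualComplex Z).faces :=
  ⟨c.nonempty, c.gen, c.gen_mem_stratum⟩

/-- If `Z` has finitely many components and every stratum has finitely many components (e.g.
`Z` closed in a Noetherian scheme) then `𝒟(Z)` has finitely many cells. [folklore] -/
theorem finite (hZ : (maxPoints Z).Finite)
    (hS : ∀ J : Finset (maxPoints Z), (maxPoints (stratum Z J)).Finite) : Finite (Cell Z) := by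
  haveI := hZ.to_subtype
  haveI : ∀ J : Finset (maxPoints Z), Finite (maxPoints (stratum Z J)) :=
    fun J => (hS J).to_subtype
  refine Finite.of_injective
    (fun c => (⟨c.J, c.gen, c.gen_mem⟩ : Σ J : Finset (maxPoints Z), maxPoints (stratum Z J))) ?_
  rintro ⟨J, hJ, g, hg⟩ ⟨J', hJ', g', hg'⟩ h
  obtain ⟨rfl, h2⟩ := Sigma.mk.inj_iff.mp h
  exact Cell.ext rfl (Subtype.ext_iff.mp (eq_of_heq h2))

/-- The empty subset has no cells: `𝒟(∅) = ∅`. [folklore] -/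
instance isEmpty_of_empty : IsEmpty (Cell (∅ : Set α)) :=
  ⟨fun c => by
    obtain ⟨η, -⟩ := c.nonempty
    exact η.2.1⟩

end Cell

/-- **The dual complex `𝒟(Z)` is simplicial** (de Fernex–Kollár–Xu 2012, Definition 8: "`𝒟(Z)` is
a simplicial complex iff `⋂_{i ∈ J} Zᵢ` is irreducible (or empty) for every `J ⊂ I`"): every
stratum `Z_J` has at most one maximal point. Then `𝒟(Z)` is the nerve `Motives.dualComplex Z`
(`Cell.J` is then injective, `IsSimplicial.J_injective`, and surjective onto its faces by
`Cell.J_mem_dualComplex_faces` and the existence of maximal points of non-empty strata on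
Noetherian sober spaces).
[cite: FernexKollarXu2012, Definition 8] -/
def IsSimplicial (Z : Set α) : Prop :=
  ∀ J : Finset (maxPoints Z), (maxPoints (stratum Z J)).Subsingleton

/-- For a simplicial dual complex, a cell is determined by its set of components. [folklore] -/
theorem IsSimplicial.J_injective {Z : Set α} (h : IsSimplicial Z) :
    Function.Injective (Cell.J (Z := Z)) :=
  fun c c' hJ => Cell.ext hJ (h c.J c.gen_mem (hJ ▸ c'.gen_mem))

/-- The **dual complex `𝒟(Z)` of a subset `Z` of a topological space, in barycentric
subdivision** (de Fernex–Kollár–Xu 2012, Definition 8 with Remark 10: "The barycentric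
subdivision of any dual complex is simplicial"): the order complex of the face poset of cells
`v_W` — one cell of dimension `|J| - 1` for every irreducible component `W` of every stratum
`Z_J`, `J ≠ ∅`, with `v_{W'}` a face of `v_W` iff `J' ⊆ J` and `W ⊆ W'`. Under the hypotheses
(1–2) of loc. cit. (e.g. `Z` a simple normal crossing divisor on a smooth variety, or
`Z = Δ^{=1}` for a dlt pair `(X, Δ)`) `𝒟(Z)` is a regular `Δ`-complex and this abstract
simplicial complex is its barycentric subdivision, so it carries the PL-homeomorphism type,
the simple-homotopy type and the collapsibility of `𝒟(Z)`. When every stratum is irreducible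
(`IsSimplicial`) `𝒟(Z)` itself is the nerve `Motives.dualComplex Z`.
[cite: FernexKollarXu2012, Definition 8 and Remark 10] -/
def baryDualComplex (Z : Set α) : AbstractSimplicialComplex (Cell Z) :=
  orderComplex (Cell Z)

/-- Unfolding lemma: the simplices of `baryDualComplex Z` are the non-empty finite chains of
cells. [folklore] -/
theorem mem_baryDualComplex_faces_iff {Z : Set α} {s : Finset (Cell Z)} :
    s ∈ (baryDualComplex Z).faces ↔ s.Nonempty ∧ IsChain (· ≤ ·) (s : Set (Cell Z)) :=
  Iff.rfl

/-- The dual complex `𝒟(Z)` **as a topological space**: the geometric realisation of its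
barycentric subdivision inside `ℝ^{Cell Z}` (`Motives.stdRealisation`). [folklore] -/
abbrev baryDualComplexSpace (Z : Set α) : Type _ :=
  ↥(stdRealisation (baryDualComplex Z))

/-- The **dimension** of `𝒟(Z)`: the supremum of the dimensions of its cells (`⊥` if there is
no cell). [folklore] -/
def dualComplexDim (Z : Set α) : WithBot ℕ∞ :=
  ⨆ c : Cell Z, (c.dim : WithBot ℕ∞)

/-- Every cell bounds the dimension from below. [folklore] -/
theorem dim_le_dualComplexDim {Z : Set α} (c : Cell Z) :
    (c.dim : WithBot ℕ∞) ≤ dualComplexDim Z :=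
  le_iSup (fun c : Cell Z => (c.dim : WithBot ℕ∞)) c

end DualComplex

/-! ## Rational volume forms; the condition `K_X + B ∼ 0` on a smooth variety -/

section Forms

variable (k : Type u) [Field k] (F : Type u) [Field F] [Algebra k F] (n : ℕ)

/-- The **rational `n`-forms** `⋀ⁿ_F Ω_{F/k}` of a field extension `F/k` (Mathlib's Kähler
differentials and exterior powers). For `F = K(X)` the function field of an `n`-dimensional
smooth `k`-variety `X` these are the rational sections of the canonical bundle
`ω_X = Ωⁿ_{X/k}` (rational volume forms). [folklore] -/
abbrev RatForms : Type u :=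
  ↥(⋀[F]^n (Ω[F⁄k]))

variable {X : Scheme.{u}} [IsIntegral X] [X.Over (Spec (.of k))]

/-- The local ring `𝒪_{X,p} ⊆ K(X)` of an integral `k`-scheme read inside a field `F` through a
**chart** `e : F ≃ₐ[k] K(X)` (a `k`-isomorphism onto the function field; `e = AlgEquiv.refl` is
the case `F = K(X)`; a general `e` encodes a birational identification). [folklore] -/
def stalkSubring (e : F ≃ₐ[k] X.functionField) (p : X) : Subring F :=
  ((e.symm : X.functionField →+* F).comp (RatFn.toFunctionField p)).range

variable {k F} in
/-- Membership in `stalkSubring`: the elements `e⁻¹(g)` for `g ∈ 𝒪_{X,p} ⊆ K(X)`. [folklore] -/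
theorem mem_stalkSubring_iff {e : F ≃ₐ[k] X.functionField} {p : X} {a : F} :
    a ∈ stalkSubring k F e p ↔ ∃ g : X.presheaf.stalk p, e.symm (RatFn.toFunctionField p g) = a :=
  Iff.rfl

/-- The **regular `n`-forms at `p`**, `Ωⁿ_{X,p} ⊆ ⋀ⁿ Ω_{K(X)/k}` (read in `F` through the chart
`e`): the `𝒪_{X,p}`-span of the forms `dg₁ ∧ ⋯ ∧ dgₙ` with `g₁, …, gₙ ∈ 𝒪_{X,p}`, i.e. the image of
`⋀ⁿ_{𝒪_{X,p}} Ω_{𝒪_{X,p}/k} → ⋀ⁿ_{K(X)} Ω_{K(X)/k}`. For `X` smooth over `k` of relative dimension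
`n` at `p` this is the stalk of the canonical bundle `ω_X = Ωⁿ_{X/k}`, a free `𝒪_{X,p}`-module
of rank one spanned by `dx₁ ∧ ⋯ ∧ dxₙ` for local coordinates `xᵢ` (Hartshorne II.8,
Thm. 8.15 and the definition of the canonical sheaf, p. 180). [folklore] -/
def regularForms (e : F ≃ₐ[k] X.functionField) (p : X) :
    Submodule (stalkSubring k F e p) (RatForms k F n) :=
  Submodule.span (stalkSubring k F e p)
    (Set.range fun g : Fin n → stalkSubring k F e p =>
      exteriorPower.ιMulti F n fun i => KaehlerDifferential.D k F (g i))

/-- **`ω` is a logarithmic volume form with poles exactly along `B`: `div(ω) = -B`, i.e. `ω` is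
a nowhere vanishing section of `ω_X(B) = 𝒪_X(K_X + B)`** — for a rational `n`-form `ω` (read in
`F` through the chart `e`) and a subset `B ⊆ X` (a reduced divisor, through the vanishing ideal
sheaf `I_B` of its closure, Mathlib's `vanishingIdeal`): at every point `p` of `X` and for every
local equation `b` of `B` at `p` (a generator of the stalk `(I_B)_p`, `Resolution.stalkIdeal`;
`b` is a unit off `B`), the form `b · ω` generates the `𝒪_{X,p}`-module `Ωⁿ_{X,p}` of regular
`n`-forms at `p`. For `X` smooth of relative dimension `n` over `k` and `B` an effective Cartier
divisor (e.g. a strict normal crossings divisor) such an `ω` EXISTS iff the Cartier divisor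
`K_X + B` is linearly equivalent to `0` (`K_X = div(ω₀)` for any rational volume form `ω₀ ≠ 0`;
`K_X + B = div(h)` iff `ω = h⁻¹ ω₀` has `div(ω) = -B`; Hartshorne II.6.11–6.13 and II.8, p. 180)
— the condition "`K_X + B ∼ 0`" of a log Calabi–Yau pair (Mauri–Moraga 2024, Def. 1.1, with
`ℤ`-linear equivalence; Kollár–Xu 2016, Def. 1). The predicate is only meaningful when `I_B`
is locally principal (at a point where `(I_B)_p` is not principal the clause is vacuous); it
is used for strict normal crossings `B`, where `(I_B)_p = (x₁ ⋯ x_r)`.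
[cite: MauriMoraga2024, Definition 1.1] -/
def IsLogVolumeFormVia (e : F ≃ₐ[k] X.functionField) (B : Set X) (ω : RatForms k F n) : Prop :=
  ∀ (p : X) (b : X.presheaf.stalk p),
    stalkIdeal (vanishingIdeal ⟨closure B, isClosed_closure⟩) p = Ideal.span {b} →
    Submodule.span (stalkSubring k F e p) {e.symm (RatFn.toFunctionField p b) • ω} =
      regularForms k F n e p

/-- `div(ω) = -B` for a rational `n`-form `ω ∈ ⋀ⁿ Ω_{K(X)/k}` on `X` itself (chart
`e = AlgEquiv.refl`): `ω` is a nowhere vanishing section of `𝒪_X(K_X + B)`.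
[cite: MauriMoraga2024, Definition 1.1] -/
abbrev IsLogVolumeForm (B : Set X) (ω : RatForms k X.functionField n) : Prop :=
  IsLogVolumeFormVia k X.functionField n AlgEquiv.refl B ω

variable {k F n}

/-- Unfolding lemma for `IsLogVolumeFormVia`. [folklore] -/
theorem isLogVolumeFormVia_iff {e : F ≃ₐ[k] X.functionField} {B : Set X} {ω : RatForms k F n} :
    IsLogVolumeFormVia k F n e B ω ↔ ∀ (p : X) (b : X.presheaf.stalk p),
      stalkIdeal (vanishingIdeal ⟨closure B, isClosed_closure⟩) p = Ideal.span {b} →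
      Submodule.span (stalkSubring k F e p) {e.symm (RatFn.toFunctionField p b) • ω} =
        regularForms k F n e p :=
  Iff.rfl

/-- A logarithmic volume form does not depend on `B` beyond its closure (the divisor is the
reduced closed subscheme carried by `\overline{B}`). [folklore] -/
theorem IsLogVolumeFormVia.of_closure_eq {e : F ≃ₐ[k] X.functionField} {B B' : Set X}
    {ω : RatForms k F n} (h : IsLogVolumeFormVia k F n e B ω) (hB : closure B = closure B') :
    IsLogVolumeFormVia k F n e B' ω := by
  intro p b hb
  refine h p b ?_
  convert hb using 4

/-- **Off the boundary a logarithmic volume form is a local generator of the canonical bundle**: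
for `p ∉ \overline{B}` the local equation may be taken to be `1`, so `ω` itself generates
`Ωⁿ_{X,p}` (`ω` is regular and nowhere vanishing on `X ∖ B`). [folklore] -/
theorem IsLogVolumeFormVia.span_singleton_eq {e : F ≃ₐ[k] X.functionField} {B : Set X}
    {ω : RatForms k F n} (h : IsLogVolumeFormVia k F n e B ω) {p : X} (hp : p ∉ closure B) :
    Submodule.span (stalkSubring k F e p) {ω} = regularForms k F n e p := by
  have hp' : p ∉ (vanishingIdeal ⟨closure B, isClosed_closure⟩ : X.IdealSheafData).support := by
    rwa [← SetLike.mem_coe, coe_support_vanishingIdeal]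
  have htop : stalkIdeal (vanishingIdeal ⟨closure B, isClosed_closure⟩) p = ⊤ := by
    by_contra h'
    exact hp' ((mem_support_iff_stalkIdeal_le _ p).mpr (IsLocalRing.le_maximalIdeal h'))
  have key := h p 1 (by rw [Ideal.span_singleton_one]; exact htop)
  simpa using key

end Forms

/-! ## Numerical equivalence of Cartier divisors and the Picard number -/

section Picard

variable {k : Type u} [Field k]

/-- A Cartier divisor `D` on an integral `k`-scheme `X` is **numerically trivial**, `D ≡ 0`:
`deg (D|_C) = 0` for every integral closed curve `C ⊆ X` proper over `k` (the degree
`CartierDivisor.degree` of the pulled-back divisor class `CartierDivisor.classPullback` along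
the closed immersion). [folklore] -/
def IsNumericallyTrivial (X : SchemeOver k) [IsIntegral X.left] (D : CartierDivisor X.left) :
    Prop :=
  ∀ (C : SchemeOver k) [IsIntegral C.left] [IsProper C.hom] (ι : C ⟶ X),
    IsClosedImmersion ι.left → topologicalKrullDim C.left = 1 →
    CartierDivisor.degree C (D.classPullback ι.left) = 0

/-- A family `D₁, …, D_r` of Cartier divisors is **numerically independent**: no non-trivial
integer combination `Σ aᵢ Dᵢ` is numerically trivial, i.e. the intersection numbers with closed
integral curves `C ⊆ X`, `a ↦ (Σ aᵢ deg(Dᵢ|_C))_C`, detect `a = 0`. The classes of the `Dᵢ` are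
then linearly independent in `N¹(X) = Div(X)/≡`. [folklore] -/
def NumericallyIndependent (X : SchemeOver k) [IsIntegral X.left] {r : ℕ}
    (D : Fin r → CartierDivisor X.left) : Prop :=
  ∀ a : Fin r → ℤ,
    (∀ (C : SchemeOver k) [IsIntegral C.left] [IsProper C.hom] (ι : C ⟶ X),
      IsClosedImmersion ι.left → topologicalKrullDim C.left = 1 →
      ∑ i, a i * CartierDivisor.degree C ((D i).classPullback ι.left) = 0) → a = 0

/-- The empty family is numerically independent. [folklore] -/
theorem numericallyIndependent_of_isEmpty (X : SchemeOver k) [IsIntegral X.left]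
    (D : Fin 0 → CartierDivisor X.left) : NumericallyIndependent X D :=
  fun _ _ => funext fun i => i.elim0

/-- The **Picard number `ρ(X)`**: the rank of the group `N¹(X)` of Cartier divisors modulo
numerical equivalence, as the largest size of a numerically independent family (junk value
`0` if there were arbitrarily large ones, which the theorem of the base — `N¹(X)` is finitely
generated for `X` proper over a field — excludes). For `X` smooth and projective over an
algebraically closed field this is the rank of the Néron–Severi group of divisors modulo
ALGEBRAIC equivalence (algebraic and numerical equivalence of divisors agree up to torsion,
Matsusaka 1957), which is the `ρ` of Brown–McKernan–Svaldi–Zong 2018, Def. 7 ("the rank of the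
group of Weil divisors modulo algebraic equivalence … If `X` is `ℚ`-factorial then `ρ` is the
Picard number") and the `rank Cl(X)_ℚ` of Mauri–Moraga 2024, Def. 2.25 as used there
(`= ρ(X)` for `ℚ`-factorial `X`, loc. cit. Lemmas 2.30–2.31). [folklore] -/
def picardNumber (X : SchemeOver k) [IsIntegral X.left] : ℕ :=
  sSup {r | ∃ D : Fin r → CartierDivisor X.left, NumericallyIndependent X D}

/-- `0` is always witnessed (the empty family), so the set defining `ρ(X)` is non-empty.
[folklore] -/
theorem zero_mem_setOf_numericallyIndependent (X : SchemeOver k) [IsIntegral X.left] :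
    0 ∈ {r | ∃ D : Fin r → CartierDivisor X.left, NumericallyIndependent X D} :=
  ⟨fun i => i.elim0, numericallyIndependent_of_isEmpty X _⟩

end Picard

/-! ## Log Calabi–Yau pairs with simple normal crossings -/

section Pairs

variable (k : Type u) [Field k] (n : ℕ)

/-- A **log Calabi–Yau pair `(X, B)` of dimension `n` with simple normal crossings** over the
field `k` (Mauri–Moraga 2024, Def. 1.1: "A log Calabi–Yau pair `(X,B)` consists of a proper
variety `X` and an effective `ℝ`-divisor `B` such that the pair `(X,B)` is log canonical and
`K_X + B` is `ℝ`-linearly trivial"; Kollár–Xu 2016, Def. 1 with `K_X + Δ ∼_ℚ 0`), in the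
LOG SMOOTH, REDUCED-BOUNDARY case with `ℤ`-linear triviality — the case `(X, Δ)` snc,
`Δ = Δ^{=1}`, `K_X + Δ ∼ 0`, which is automatically log canonical (indeed dlt with `Z = ∅`;
Kollár–Mori 1998, Cor. 2.31 (3) and Def. 2.37) and in which the dual complex is defined directly
(de Fernex–Kollár–Xu 2012, Definition 8 (4)):
* `X` is an integral scheme, proper and smooth of relative dimension `n` over `k`;
* the boundary `B ⊆ X` is a strict normal crossings divisor (`Resolution.IsStrictNormalCrossingsDivisor`,
  de Jong 1996, 2.4: closed, `X` regular along `B`, `B` cut out at each of its points by a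
  product `x₁ ⋯ x_r` of part of a regular system of parameters), read as the reduced divisor
  `Σ Bᵢ` of its irreducible components — `B = ∅` (Calabi–Yau `X`) is allowed;
* `K_X + B ∼ 0`: there is a rational volume form `ω ∈ ⋀ⁿ Ω_{K(X)/k}` with `div(ω) = -B`
  (`IsLogVolumeForm`).
General log canonical / dlt pairs, `ℝ`-boundaries and `ℝ`-linear triviality are NOT covered
(TODO(general form): they need discrepancies, which the tree does not have yet).
[cite: MauriMoraga2024, Definition 1.1] -/
structure SncLogCalabiYauPair where
  /-- the ambient variety `X → Spec k` -/
  X : SchemeOver k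
  /-- `X` is integral -/
  [isIntegral : IsIntegral X.left]
  /-- `X` is proper over `k` -/
  isProper : IsProper X.hom
  /-- `X` is smooth of relative dimension `n` over `k` -/
  smoothOfRelativeDimension : SmoothOfRelativeDimension n X.hom
  /-- the boundary `B`, a closed subset read as the reduced divisor of its components -/
  B : Set X.left
  /-- `B` is a strict normal crossings divisor on `X` -/
  isStrictNormalCrossingsDivisor : IsStrictNormalCrossingsDivisor X.left B
  /-- `K_X + B ∼ 0`: some rational volume form has divisor `-B` -/
  exists_isLogVolumeForm : ∃ ω : RatForms k X.left.functionField n, IsLogVolumeForm k n B ω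

namespace SncLogCalabiYauPair

variable {k n}

/-- The ambient scheme of an snc log Calabi–Yau pair is integral (the structure field, made
available to instance search). [folklore] -/
instance isIntegral_left (P : SncLogCalabiYauPair k n) : IsIntegral P.X.left :=
  P.isIntegral

/-- The boundary of an snc log Calabi–Yau pair is closed. [folklore] -/
theorem isClosed_B (P : SncLogCalabiYauPair k n) : IsClosed P.B :=
  P.isStrictNormalCrossingsDivisor.isClosed

/-- The structure morphism of an snc log Calabi–Yau pair is proper. [folklore] -/
instance isProper_hom (P : SncLogCalabiYauPair k n) : IsProper P.X.hom :=
  P.isProper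

/-- The structure morphism of an snc log Calabi–Yau pair is smooth of relative dimension `n`.
[folklore] -/
instance smoothOfRelativeDimension_hom (P : SncLogCalabiYauPair k n) :
    SmoothOfRelativeDimension n P.X.hom :=
  P.smoothOfRelativeDimension

/-- The **number of boundary components `|B|`** (the sum of the coefficients of the reduced
divisor `B = Σ Bᵢ`): the number of maximal points of `B` (`Set.ncard`, junk value `0` if
infinite, which does not happen on the Noetherian scheme `X`). [cite: MauriMoraga2024, Definition 2.25] -/
def numComponents (P : SncLogCalabiYauPair k n) : ℕ :=
  (maxPoints P.B).ncard

/-- The **complexity** `c(X, B) = dim X + ρ(X) - |B|` of an snc log Calabi–Yau pair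
(Mauri–Moraga 2024, Def. 2.25: "`c(X,B,𝐌) := dim X + rank Cl_ℚ(X) - |B|`";
Brown–McKernan–Svaldi–Zong 2018, Def. 7, the absolute complexity `γ = n + ρ - d`), with
`dim X = n`, `ρ(X) = picardNumber` (see there for the identification with the printed `ρ`)
and `|B| = numComponents`. It is `≥ 0` by loc. cit. Thm. 2.26 (BMSZ 2018, Thm. 1.2), not
used here. [cite: MauriMoraga2024, Definition 2.25] -/
def complexity (P : SncLogCalabiYauPair k n) : ℤ :=
  (n : ℤ) + (picardNumber P.X : ℤ) - (P.numComponents : ℤ)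

/-- **Crepant birational snc log Calabi–Yau pairs** (Mauri–Moraga 2024, Def. 2.27: `X'` is
birational to `X` and on a common resolution `p : Y → X`, `q : Y → X'` one has
`p^*(K_X + B) = q^*(K_{X'} + B')`). Rendered WITHOUT resolutions, in the equivalent form
available when `K_X + B ∼ 0` and `K_{X'} + B' ∼ 0`: there are a birational identification
`σ : K(X) ≃ₐ[k] K(X')` (for varieties over `k`, a `k`-isomorphism of function fields is the
same as a birational map `X ⇢ X'`) and ONE rational volume form `ω ∈ ⋀ⁿ Ω_{K(X)/k}` with
`div_X(ω) = -B` and `div_{X'}(σ_* ω) = -B'`. (Equivalence with loc. cit.: with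
`K_Y = div_Y(ω)`, `K_X = div_X(ω)`, `K_{X'} = div_{X'}(ω)` the log pull-backs are
`B_Y = p^*(div_X ω + B) - div_Y ω` and `B'_Y = q^*(div_{X'} ω + B') - div_Y ω`; if both
divisors of `ω` are `-B`, `-B'` then `B_Y = B'_Y = -div_Y ω`; conversely if `B_Y = B'_Y` for one
`ω` with `div_X ω = -B` then `q^*(div_{X'} ω + B') = 0`, hence `div_{X'} ω = -B'` as `q` is
birational onto the smooth `X'`.) Symmetric and reflexive; composition of the `σ`'s gives
transitivity. [cite: MauriMoraga2024, Definition 2.27] -/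
def IsCrepantBirational (P P' : SncLogCalabiYauPair k n) : Prop :=
  ∃ (σ : P.X.left.functionField ≃ₐ[k] P'.X.left.functionField)
    (ω : RatForms k P.X.left.functionField n),
    IsLogVolumeForm k n P.B ω ∧ IsLogVolumeFormVia k P.X.left.functionField n σ P'.B ω

/-- Every snc log Calabi–Yau pair is a crepant model of itself (`σ = id`, `ω` the volume form
of the definition). [folklore] -/
theorem IsCrepantBirational.refl (P : SncLogCalabiYauPair k n) : P.IsCrepantBirational P := by
  obtain ⟨ω, hω⟩ := P.exists_isLogVolumeForm
  exact ⟨AlgEquiv.refl, ω, hω, hω⟩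

/-- **`c_bir(X, B) < m` over snc models**: some crepant birational snc log Calabi–Yau pair has
complexity `< m` (Mauri–Moraga 2024, Def. 2.28: `c_bir` is the infimum of the complexities of
the crepant models; there over ALL generalized log Calabi–Yau crepant models, attained by a
`ℚ`-factorial dlt one, Lemma 2.31). Restricting to snc models with reduced boundary can only
raise the infimum, so this predicate IMPLIES `c_bir(X,B) < m` in the sense of loc. cit.
(TODO(general form): dlt models). [cite: MauriMoraga2024, Definition 2.28] -/
def BirationalComplexityLT (P : SncLogCalabiYauPair k n) (m : ℤ) : Prop :=
  ∃ P' : SncLogCalabiYauPair k n, P.IsCrepantBirational P' ∧ P'.complexity < m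

/-- The **birational complexity over snc models**, `inf { c(X', B') }` over the snc log
Calabi–Yau pairs crepant birational to `(X, B)` (Mauri–Moraga 2024, Def. 2.28, restricted to
snc models — an upper bound for the printed `c_bir`; `sInf` on `ℤ`, meaningful because
complexities are `≥ 0`, loc. cit. Prop. 2.29). Prefer the junk-free `BirationalComplexityLT`
in statements. [cite: MauriMoraga2024, Definition 2.28] -/
def sncBirationalComplexity (P : SncLogCalabiYauPair k n) : ℤ :=
  sInf {c | ∃ P' : SncLogCalabiYauPair k n, P.IsCrepantBirational P' ∧ P'.complexity = c}

/-- The complexity of the pair itself bounds `c_bir` strictly from above by any larger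
integer: `c(X,B) < m → c_bir(X,B) < m`. [folklore] -/
theorem birationalComplexityLT_of_complexity_lt (P : SncLogCalabiYauPair k n) {m : ℤ}
    (h : P.complexity < m) : P.BirationalComplexityLT m :=
  ⟨P, IsCrepantBirational.refl P, h⟩

/-! ### The dual complex of the pair -/

/-- The **dual complex `𝒟(X, B)`** of an snc log Calabi–Yau pair, in barycentric subdivision:
the finite abstract simplicial complex `baryDualComplex B` on the cells `v_W` (`W` an
irreducible = connected component of `B_{i₀} ∩ ⋯ ∩ B_{i_k}`; de Fernex–Kollár–Xu 2012,
Definition 8 (4); Mauri–Moraga 2024, Def. 2.20 for dlt pairs: "the regular `Δ`-complex whose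
vertices correspond to irreducible components of `B^{=1}` and whose `k`-cells correspond to
strata of `B^{=1}`, i.e., connected components of `B_{i₀} ∩ ⋯ ∩ B_{i_k}`" — for an snc pair the
strata are regular schemes, so their connected components are their irreducible components).
Its PL-homeomorphism type is that of `𝒟(X,B)` (the barycentric subdivision of a regular
`Δ`-complex), a crepant birational invariant (loc. cit. Def. 2.21; de Fernex–Kollár–Xu 2012,
Prop. 11). [cite: MauriMoraga2024, Definition 2.20] -/
def dualComplex (P : SncLogCalabiYauPair k n) : AbstractSimplicialComplex (Cell P.B) :=
  baryDualComplex P.B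

/-- The **dual complex `𝒟(X, B)` of an snc log Calabi–Yau pair as a topological space**: the
geometric realisation `|𝒟(X,B)| ⊆ ℝ^{cells}` of its barycentric subdivision `dualComplex`
(`Motives.stdRealisation`, subspace topology) — the space whose PL-homeomorphism / homotopy
type the sources call the dual complex of the pair (Mauri–Moraga 2024, Def. 2.20–2.21;
Kollár–Xu 2016, Def. 1 and Def. 12). [cite: MauriMoraga2024, Definition 2.20] -/
abbrev LogCalabiYauDualComplex (P : SncLogCalabiYauPair k n) : Type u :=
  baryDualComplexSpace P.B

/-- Unfolding lemma: `dualComplex P` is `baryDualComplex P.B`. [folklore] -/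
theorem dualComplex_eq (P : SncLogCalabiYauPair k n) : P.dualComplex = baryDualComplex P.B :=
  rfl

/-- The simplices of `𝒟(X, B)` (barycentric form) are the non-empty chains of strata
`v_{W₀} < v_{W₁} < ⋯`. [folklore] -/
theorem mem_dualComplex_faces_iff (P : SncLogCalabiYauPair k n) {s : Finset (Cell P.B)} :
    s ∈ P.dualComplex.faces ↔ s.Nonempty ∧ IsChain (· ≤ ·) (s : Set (Cell P.B)) :=
  Iff.rfl

/-- The vertices of `𝒟(X, B)` are points of the space `LogCalabiYauDualComplex P`. [folklore] -/
def dualComplexVertex (P : SncLogCalabiYauPair k n) (η : maxPoints P.B) :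
    P.LogCalabiYauDualComplex := by
  classical
  exact ⟨Pi.single (Cell.vertex η) 1, single_mem_stdRealisation (baryDualComplex P.B) _⟩

/-- The **dimension of `𝒟(X, B)`** (supremum of the dimensions `|J| - 1` of its cells; `⊥`
for `B = ∅`). Mauri–Moraga 2024, Def. 2.23 define the coregularity as
`dim X - dim 𝒟(X,B) - 1`. [folklore] -/
def dualComplexDim (P : SncLogCalabiYauPair k n) : WithBot ℕ∞ :=
  LogCalabiYau.dualComplexDim P.B

end SncLogCalabiYauPair

/-! ### Non-vacuity: varieties with trivial canonical form in dimension `0` (the point) -/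

/-- On any integral `k`-scheme the `0`-form `1 ∈ ⋀⁰ Ω_{K(X)/k} = K(X)` has divisor `-∅ = 0` in
the sense of `IsLogVolumeForm` with `n = 0`: `⋀⁰` of anything is spanned by the empty wedge,
and a local equation of the empty divisor is a unit. (Sanity check of the clauses; for `X`
of dimension `0`, i.e. `X = Spec k'`, this is the statement `K_X ∼ 0`.) [folklore] -/
theorem isLogVolumeForm_empty_zero (k : Type u) [Field k] (X : Scheme.{u}) [IsIntegral X]
    [X.Over (Spec (.of k))] :
    IsLogVolumeForm k 0 (∅ : Set X)
      (exteriorPower.ιMulti X.functionField 0 fun i => i.elim0) := by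
  intro p b hb
  set S := stalkSubring k X.functionField (AlgEquiv.refl) p with hS
  -- the local equation `b` of `∅` is a unit
  have hp' : p ∉ (vanishingIdeal ⟨closure (∅ : Set X), isClosed_closure⟩ : X.IdealSheafData).support := by
    rw [← SetLike.mem_coe, coe_support_vanishingIdeal]
    simp
  have htop : stalkIdeal (vanishingIdeal ⟨closure (∅ : Set X), isClosed_closure⟩) p = ⊤ := by
    by_contra h'
    exact hp' ((mem_support_iff_stalkIdeal_le _ p).mpr (IsLocalRing.le_maximalIdeal h'))
  have hbu : IsUnit b := by
    rw [htop, eq_comm, Ideal.span_singleton_eq_top] at hb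
    exact hb
  -- `⋀⁰` is spanned by the empty wedge, whatever the entries
  have hreg : regularForms k X.functionField 0 AlgEquiv.refl p =
      Submodule.span S {exteriorPower.ιMulti X.functionField 0 fun i => i.elim0} := by
    unfold regularForms
    rw [Set.range_unique]
    congr 2
  rw [hreg]
  -- a unit multiple spans the same line
  let φ : X.presheaf.stalk p →+* X.functionField :=
    ((AlgEquiv.refl : X.functionField ≃ₐ[k] X.functionField).symm :
      X.functionField →+* X.functionField).comp (RatFn.toFunctionField p)
  have hu : IsUnit (φ.rangeRestrict b) := hbu.map _
  exact Submodule.span_singleton_smul_eq (M := RatForms k X.functionField 0) hu _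

/-- **The point is an snc log Calabi–Yau pair of dimension `0`**: `X = Spec k` over `k`, empty
boundary, volume form `1` (non-vacuity of the clauses of `SncLogCalabiYauPair`). [folklore] -/
def SncLogCalabiYauPair.point (k : Type u) [Field k] : SncLogCalabiYauPair k 0 where
  X := Over.mk (𝟙 (Spec (.of k)))
  isIntegral := inferInstanceAs (IsIntegral (Spec (.of k)))
  isProper := inferInstanceAs (IsProper (𝟙 (Spec (.of k))))
  smoothOfRelativeDimension := inferInstanceAs (SmoothOfRelativeDimension 0 (𝟙 (Spec (.of k))))
  B := ∅
  isStrictNormalCrossingsDivisor := IsStrictNormalCrossingsDivisor.empty _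
  exists_isLogVolumeForm :=
    letI : (Spec (CommRingCat.of k)).Over (Spec (.of k)) := ⟨𝟙 _⟩
    ⟨_, isLogVolumeForm_empty_zero k (Spec (.of k))⟩

/-- The point has no boundary components. [folklore] -/
theorem SncLogCalabiYauPair.numComponents_point (k : Type u) [Field k] :
    (SncLogCalabiYauPair.point k).numComponents = 0 := by
  change (maxPoints (∅ : Set ↥(Spec (CommRingCat.of k)))).ncard = 0
  rw [Set.eq_empty_of_forall_notMem (s := maxPoints (∅ : Set ↥(Spec (CommRingCat.of k))))
    fun η h => h.1, Set.ncard_empty]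

/-- The dual complex of the point is empty (no cells). [folklore] -/
instance SncLogCalabiYauPair.isEmpty_cell_point (k : Type u) [Field k] :
    IsEmpty (Cell (SncLogCalabiYauPair.point k).B) :=
  Cell.isEmpty_of_empty

end Pairs

end Literature.AlgebraicGeometry.LogCalabiYau

end
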